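import Summits.AtomisticToContinuum.BoseEinsteinCondensation.Theorems.BECRewardDescentRewardChordBoundModulusOfSimpleSpan

/-!
# Stub `stub_modulusOfSimple` of crux `RewardChordBound` (stmt-AtomisticToContinuum-12876, line
# `registered`): the derivative-free susceptibility bound `2R(s) ≤ R(s+h) + R(s-h) + 2h²V/(g - 2hN)`

For the reward infimum `R(t) = inf_Ψ (E(Ψ) + t(N - n₀(Ψ)))` over periodic `C¹` trial states at fixed
`(N, L)`: translation-invariant near-minimisers on `[s-h, s+h]`, the invariant Ky-Fan gap `g` above
`R(s)` and the variance bound `‖n̂₀Ψ‖² ≤ n₀(Ψ)² + V` for near-minimisers of `F_s` imply the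
second-difference bound. The `2 × 2` Temple/Feshbach lower bound is `ModulusOfSimple.core_bound`
(helper file 3); here: the choice of the precision `δ` (`exists_precision`), the infimum over invariant
`Φ` at `t = s ± h`, the cancellation of `±h·dep(Ψ)`, `δ → 0`, the `ℝ≥0∞` bookkeeping, and the trivial
case `N = 0` (`R` constant). [folklore]
-/

noncomputable section

namespace Summit.AtomisticToContinuum.BoseEinsteinCondensation.Cruxes.RewardChordBound.Birth

namespace ModulusOfSimple

open MeasureTheory Filter
open scoped ENNReal NNReal ComplexConjugate
open Literature.MathematicalPhysics.QuantumManyBody.BoseGas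

/-! ### Assembly: the second-difference bound -/

section Assembly

variable {n : ℕ} {L : ℝ} {v : ℝ → ℝ≥0∞}

/-- Choice of the precision `δ`: for `h, N, g, ε > 0` there is `0 < δ ≤ 1` with `δ ≤ hN/2` and
`√δ g ≤ hN/2` (so that `(1 - √δ)(g - δ) - hN ≥ g - 2hN`) and `2√δ ≤ ε`. [folklore] -/
theorem exists_precision {h Nr g ε : ℝ} (hh : 0 < h) (hN : 0 < Nr) (hg : 0 < g) (hε : 0 < ε) :
    ∃ δ : ℝ, 0 < δ ∧ δ ≤ 1 ∧ δ ≤ h * Nr / 2 ∧ g - 2 * h * Nr ≤ (1 - Real.sqrt δ) * (g - δ) - h * Nr ∧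
      2 * Real.sqrt δ ≤ ε := by
  set c := h * Nr with hc
  have hc0 : 0 < c := mul_pos hh hN
  refine ⟨min 1 (min (c / 2) (min ((c / (2 * g)) ^ 2) ((ε / 2) ^ 2))), ?_, min_le_left _ _,
    (min_le_right _ _).trans (min_le_left _ _), ?_, ?_⟩
  · positivity
  · set δ := min 1 (min (c / 2) (min ((c / (2 * g)) ^ 2) ((ε / 2) ^ 2))) with hδ
    have hδ0 : 0 < δ := by positivity
    have hδc : δ ≤ c / 2 := (min_le_right _ _).trans (min_le_left _ _)
    have hδ2 : δ ≤ (c / (2 * g)) ^ 2 := (min_le_right _ _).trans ((min_le_right _ _).trans (min_le_left _ _))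
    have hs : Real.sqrt δ ≤ c / (2 * g) := by
      rw [← Real.sqrt_sq (by positivity : 0 ≤ c / (2 * g))]; exact Real.sqrt_le_sqrt hδ2
    have hsg : Real.sqrt δ * g ≤ c / 2 := by
      calc Real.sqrt δ * g ≤ c / (2 * g) * g := mul_le_mul_of_nonneg_right hs hg.le
        _ = c / 2 := by field_simp
    have hsd : 0 ≤ Real.sqrt δ * δ := mul_nonneg (Real.sqrt_nonneg _) hδ0.le
    have hexp : (1 - Real.sqrt δ) * (g - δ) = g - δ - Real.sqrt δ * g + Real.sqrt δ * δ := by ring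
    rw [hexp, hc] at *
    linarith
  · set δ := min 1 (min (c / 2) (min ((c / (2 * g)) ^ 2) ((ε / 2) ^ 2))) with hδ
    have hδ2 : δ ≤ (ε / 2) ^ 2 := (min_le_right _ _).trans ((min_le_right _ _).trans (min_le_right _ _))
    have hs : Real.sqrt δ ≤ ε / 2 := by
      rw [← Real.sqrt_sq (by positivity : 0 ≤ ε / 2)]; exact Real.sqrt_le_sqrt hδ2
    linarith

/-- **The second-difference bound for `N = n + 1` particles** (the statement of
`stub_modulusOfSimple` with the reward infimum written out). [folklore] -/
theorem modulus_succ (hv : Measurable v) {s h g V : ℝ} (hh : 0 < h) (hhs : h < s) (hg : 0 < g)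
    (hgN : 2 * h * (n + 1 : ℕ) < g)
    (hR : (⨅ Ψ : PeriodicTrialState (n + 1) L, (periodicEnergy v Ψ +
        ENNReal.ofReal s * (((n + 1 : ℕ) : ℝ≥0∞) - condensateOccupation (n + 1) L Ψ.ψ))) ≠ ⊤)
    (hZM : ∀ t : ℝ, s - h ≤ t → t ≤ s + h → ∀ δ : ℝ≥0∞, 0 < δ →
      ∃ Ψ : PeriodicTrialState (n + 1) L,
        (∀ (X : Config (n + 1)) (t : EuclideanSpace ℝ (Fin 3)), Ψ.ψ (fun i => X i + t) = Ψ.ψ X) ∧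
        periodicEnergy v Ψ + ENNReal.ofReal t * (((n + 1 : ℕ) : ℝ≥0∞) - condensateOccupation (n + 1) L Ψ.ψ) ≤
          (⨅ Ψ : PeriodicTrialState (n + 1) L, (periodicEnergy v Ψ +
            ENNReal.ofReal t * (((n + 1 : ℕ) : ℝ≥0∞) - condensateOccupation (n + 1) L Ψ.ψ))) + δ)
    (hGAP : ∀ Φ₁ Φ₂ : PeriodicTrialState (n + 1) L,
      (∀ (X : Config (n + 1)) (t : EuclideanSpace ℝ (Fin 3)), Φ₁.ψ (fun i => X i + t) = Φ₁.ψ X) →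
      (∀ (X : Config (n + 1)) (t : EuclideanSpace ℝ (Fin 3)), Φ₂.ψ (fun i => X i + t) = Φ₂.ψ X) →
      (∫ X in cellN (n + 1) L, conj (Φ₁.ψ X) * Φ₂.ψ X) = 0 →
      2 * (⨅ Ψ : PeriodicTrialState (n + 1) L, (periodicEnergy v Ψ +
          ENNReal.ofReal s * (((n + 1 : ℕ) : ℝ≥0∞) - condensateOccupation (n + 1) L Ψ.ψ))) +
        ENNReal.ofReal g ≤
      (periodicEnergy v Φ₁ + ENNReal.ofReal s * (((n + 1 : ℕ) : ℝ≥0∞) - condensateOccupation (n + 1) L Φ₁.ψ)) +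
        (periodicEnergy v Φ₂ + ENNReal.ofReal s * (((n + 1 : ℕ) : ℝ≥0∞) - condensateOccupation (n + 1) L Φ₂.ψ)))
    (hVAR : ∃ δ : ℝ≥0∞, 0 < δ ∧ ∀ Ψ : PeriodicTrialState (n + 1) L,
      periodicEnergy v Ψ + ENNReal.ofReal s * (((n + 1 : ℕ) : ℝ≥0∞) - condensateOccupation (n + 1) L Ψ.ψ) ≤
        (⨅ Ψ : PeriodicTrialState (n + 1) L, (periodicEnergy v Ψ +
          ENNReal.ofReal s * (((n + 1 : ℕ) : ℝ≥0∞) - condensateOccupation (n + 1) L Ψ.ψ))) + δ →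
      ENNReal.ofReal ((L ^ 3)⁻¹ ^ 2) * (∫⁻ X in cellN (n + 1) L,
        (‖∑ i : Fin (n + 1), ∫ y in cell L, Ψ.ψ (Function.update X i y)‖₊ : ℝ≥0∞) ^ 2) ≤
        condensateOccupation (n + 1) L Ψ.ψ ^ 2 + ENNReal.ofReal V) :
    2 * (⨅ Ψ : PeriodicTrialState (n + 1) L, (periodicEnergy v Ψ +
        ENNReal.ofReal s * (((n + 1 : ℕ) : ℝ≥0∞) - condensateOccupation (n + 1) L Ψ.ψ))) ≤
      (⨅ Ψ : PeriodicTrialState (n + 1) L, (periodicEnergy v Ψ +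
        ENNReal.ofReal (s + h) * (((n + 1 : ℕ) : ℝ≥0∞) - condensateOccupation (n + 1) L Ψ.ψ))) +
      (⨅ Ψ : PeriodicTrialState (n + 1) L, (periodicEnergy v Ψ +
        ENNReal.ofReal (s - h) * (((n + 1 : ℕ) : ℝ≥0∞) - condensateOccupation (n + 1) L Ψ.ψ))) +
      ENNReal.ofReal (2 * h ^ 2 * V / (g - 2 * h * (n + 1 : ℕ))) := by
  obtain ⟨Ψ₁, -, -⟩ := hZM s (by linarith) (by linarith) 1 one_pos
  have hL : 0 < L := by
    by_contra hL0
    have hempty : cellN (n + 1) L = ∅ := Set.eq_empty_iff_forall_notMem.2 fun X hX => by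
      have h0 := hX 0 0
      exact absurd ((h0.1.trans_lt h0.2).trans_le (not_lt.mp hL0)) (lt_irrefl 0)
    have h1 := Ψ₁.norm_eq
    rw [hempty, Measure.restrict_empty, lintegral_zero_measure] at h1
    exact zero_ne_one h1
  set Rs := (⨅ Ψ : PeriodicTrialState (n + 1) L, (periodicEnergy v Ψ +
        ENNReal.ofReal s * (((n + 1 : ℕ) : ℝ≥0∞) - condensateOccupation (n + 1) L Ψ.ψ))) with hRs
  set Rp := (⨅ Ψ : PeriodicTrialState (n + 1) L, (periodicEnergy v Ψ +
        ENNReal.ofReal (s + h) * (((n + 1 : ℕ) : ℝ≥0∞) - condensateOccupation (n + 1) L Ψ.ψ))) with hRp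
  set Rm := (⨅ Ψ : PeriodicTrialState (n + 1) L, (periodicEnergy v Ψ +
        ENNReal.ofReal (s - h) * (((n + 1 : ℕ) : ℝ≥0∞) - condensateOccupation (n + 1) L Ψ.ψ))) with hRm
  set Nr : ℝ := ((n + 1 : ℕ) : ℝ) with hNr
  have hNr0 : 0 < Nr := by rw [hNr]; positivity
  have hc : 0 < h * Nr := mul_pos hh hNr0
  have hA : 0 < g - 2 * h * Nr := by linarith
  -- the infinite cases
  by_cases htopp : Rp = ⊤
  · rw [htopp, top_add, top_add]; exact le_top
  by_cases htopm : Rm = ⊤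
  · rw [htopm, add_top, top_add]; exact le_top
  obtain ⟨δV, hδV, hVAR'⟩ := hVAR
  -- the real inequality
  have key : 2 * Rs.toReal ≤ Rp.toReal + Rm.toReal + 2 * h ^ 2 * max V 0 / (g - 2 * h * Nr) := by
    refine le_of_forall_pos_le_add fun ε hε => ?_
    obtain ⟨δ, hδ0, hδ1, hδc, hδA, hδε⟩ := exists_precision hh hNr0 hg hε
    have hδg : δ ≤ g := by nlinarith
    obtain ⟨Ψ, hΨinv, hΨle⟩ := hZM s (by linarith) (by linarith) (min (ENNReal.ofReal δ) δV)
      (lt_min (ENNReal.ofReal_pos.2 hδ0) hδV)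
    have hΨδ : periodicEnergy v Ψ + ENNReal.ofReal s *
        (((n + 1 : ℕ) : ℝ≥0∞) - condensateOccupation (n + 1) L Ψ.ψ) ≤ Rs + ENNReal.ofReal δ :=
      hΨle.trans (by gcongr; exact min_le_left _ _)
    have hVΨ := hVAR' Ψ (hΨle.trans (by gcongr; exact min_le_right _ _))
    have hplus : Rs.toReal + h * (Nr - (condensateOccupation (n + 1) L Ψ.ψ).toReal) -
        h ^ 2 * max V 0 / (g - 2 * h * Nr) - Real.sqrt δ ≤ Rp.toReal := by
      refine le_of_forall_pos_le_add fun ε' hε' => ?_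
      obtain ⟨Φ, hΦinv, hΦle⟩ := hZM (s + h) (by linarith) le_rfl (ENNReal.ofReal ε')
        (ENNReal.ofReal_pos.2 hε')
      have hEΦ : periodicEnergy v Φ ≠ ⊤ :=
        periodicEnergy_ne_top_of_rewarded_le (ENNReal.add_ne_top.2 ⟨htopp, ENNReal.ofReal_ne_top⟩) hΦle
      have hcore := (core_bound hL hv hh.le (by linarith) hδ0 hδ1 hδg hA hδA hR hGAP Ψ Φ hΨinv hΦinv
        hΨδ hVΨ hEΦ).1
      have h2 := ENNReal.toReal_mono (ENNReal.add_ne_top.2 ⟨htopp, ENNReal.ofReal_ne_top⟩) hΦle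
      rw [ENNReal.toReal_add htopp ENNReal.ofReal_ne_top, ENNReal.toReal_ofReal hε'.le] at h2
      linarith
    have hminus : Rs.toReal - h * (Nr - (condensateOccupation (n + 1) L Ψ.ψ).toReal) -
        h ^ 2 * max V 0 / (g - 2 * h * Nr) - Real.sqrt δ ≤ Rm.toReal := by
      refine le_of_forall_pos_le_add fun ε' hε' => ?_
      obtain ⟨Φ, hΦinv, hΦle⟩ := hZM (s - h) le_rfl (by linarith) (ENNReal.ofReal ε')
        (ENNReal.ofReal_pos.2 hε')
      have hEΦ : periodicEnergy v Φ ≠ ⊤ :=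
        periodicEnergy_ne_top_of_rewarded_le (ENNReal.add_ne_top.2 ⟨htopm, ENNReal.ofReal_ne_top⟩) hΦle
      have hcore := (core_bound hL hv hh.le (by linarith) hδ0 hδ1 hδg hA hδA hR hGAP Ψ Φ hΨinv hΦinv
        hΨδ hVΨ hEΦ).2
      have h2 := ENNReal.toReal_mono (ENNReal.add_ne_top.2 ⟨htopm, ENNReal.ofReal_ne_top⟩) hΦle
      rw [ENNReal.toReal_add htopm ENNReal.ofReal_ne_top, ENNReal.toReal_ofReal hε'.le] at h2
      linarith
    have hK2 : 2 * (h ^ 2 * max V 0 / (g - 2 * h * Nr)) = 2 * h ^ 2 * max V 0 / (g - 2 * h * Nr) := by ring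
    linarith [hplus, hminus, hδε, hK2]
  -- back to `ℝ≥0∞`
  have hK : ENNReal.ofReal (2 * h ^ 2 * max V 0 / (g - 2 * h * Nr)) =
      ENNReal.ofReal (2 * h ^ 2 * V / (g - 2 * h * Nr)) := by
    rcases le_or_gt 0 V with hV | hV
    · rw [max_eq_left hV]
    · rw [max_eq_right hV.le, mul_zero, zero_div, ENNReal.ofReal_zero, ENNReal.ofReal_of_nonpos]
      exact div_nonpos_of_nonpos_of_nonneg (by nlinarith [sq_nonneg h]) hA.le
  have h0 : 0 ≤ 2 * h ^ 2 * max V 0 / (g - 2 * h * Nr) := by positivity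
  calc 2 * Rs = ENNReal.ofReal (2 * Rs.toReal) := by
        rw [ENNReal.ofReal_mul zero_le_two, ENNReal.ofReal_ofNat, ENNReal.ofReal_toReal hR]
    _ ≤ ENNReal.ofReal (Rp.toReal + Rm.toReal + 2 * h ^ 2 * max V 0 / (g - 2 * h * Nr)) :=
        ENNReal.ofReal_le_ofReal key
    _ ≤ ENNReal.ofReal (Rp.toReal + Rm.toReal) +
          ENNReal.ofReal (2 * h ^ 2 * max V 0 / (g - 2 * h * Nr)) := ENNReal.ofReal_add_le
    _ ≤ ENNReal.ofReal Rp.toReal + ENNReal.ofReal Rm.toReal +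
          ENNReal.ofReal (2 * h ^ 2 * max V 0 / (g - 2 * h * Nr)) := by
        gcongr; exact ENNReal.ofReal_add_le
    _ = Rp + Rm + ENNReal.ofReal (2 * h ^ 2 * V / (g - 2 * h * Nr)) := by
        rw [ENNReal.ofReal_toReal htopp, ENNReal.ofReal_toReal htopm, hK]

end Assembly

end ModulusOfSimple

open ModulusOfSimple in
/-- **stub 6 — `ModulusOfSimple`** (finite volume, purely variational; the derivative-free
`χ ≤ 2 Var/Δ`). At fixed `(N, L)`, `0 < h < s`, `0 < g`, `2hN < g`, `R(s) < ∞`: IF `F_t` has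
translation-invariant near-minimisers at every precision for all `t ∈ [s−h, s+h]`, the zero-momentum
sector has the Ky-Fan gap `g` above `R(s)` for invariant orthogonal pairs (the body of `SectorGap`) and
the `δ`-near-minimisers of `F_s` have `⟨n̂₀²⟩ ≤ ⟨n̂₀⟩² + V` (the body of `CondensateVariance`), THEN
`2R(s) ≤ R(s+h) + R(s−h) + 2h²V/(g − 2hN)`. Proof: the `2 × 2` Temple/Feshbach lower bound around an
invariant near-minimiser `Ψ` of `F_s` (`ModulusOfSimple.core_bound`: Gram–Schmidt `Φ = c₀Ψ + χ̃` inside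
the invariant `C¹` class, the energy/mass/`n₀` as Hermitian forms on the span, the invariant Ky-Fan gap
for `χ̃`, Cauchy–Schwarz for `q − R‖·‖²`, and the variance bound for the polar form of `n₀` through
`n̂₀ = a₀†a₀`), the infimum over invariant `Φ`, the cancellation of `±h·dep(Ψ)`, and `δ → 0`;
`N = 0` is trivial (`R` is constant). [cite: Kato1966, Ch. II §6 and Ch. VII §4; ReedSimonIV1978, Thm XIII.5 (Temple); LSSY2005, Ch. 5 (5.17)] -/
theorem stub_modulusOfSimple :
    ∀ v : ℝ → ENNReal, Literature.MathematicalPhysics.QuantumManyBody.BoseGas.IsRepulsiveFiniteRange v → ∀ (N : ℕ) (L s h g V : ℝ), 0 < h → h < s → 0 < g → 2 * h * N < g → (⨅ Ψ : Literature.MathematicalPhysics.QuantumManyBody.BoseGas.PeriodicTrialState N L, (Literature.MathematicalPhysics.QuantumManyBody.BoseGas.periodicEnergy v Ψ + ENNReal.ofReal s * ((N : ENNReal) - Literature.MathematicalPhysics.QuantumManyBody.BoseGas.condensateOccupation N L Ψ.ψ))) ≠ ⊤ → (∀ t : ℝ, s - h ≤ t → t ≤ s + h → (∀ δ : ENNReal,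 0 < δ → ∃ Ψ : Literature.MathematicalPhysics.QuantumManyBody.BoseGas.PeriodicTrialState N L, (∀ (X : Literature.MathematicalPhysics.QuantumManyBody.BoseGas.Config N) (t : EuclideanSpace ℝ (Fin 3)), Ψ.ψ (fun i => X i + t) = Ψ.ψ X) ∧ (Literature.MathematicalPhysics.QuantumManyBody.BoseGas.periodicEnergy v Ψ + ENNReal.ofReal t * ((N : ENNReal) - Literature.MathematicalPhysics.QuantumManyBody.BoseGas.condensateOccupation N L Ψ.ψ)) ≤ (⨅ Ψ : Literature.MathematicalPhysics.QuantumManyBody.BoseGas.PeriodicTrialState N L, (Literature.MathematicalPhysics.QuantumManyBody.BoseGas.periodicEnergy v Ψ + ENNReal.ofReal t * ((N : ENNReal) - Literature.MathematicalPhysics.QuantumManyBody.BoseGas.condensateOccupation N L Ψ.ψ))) + δ)) → (∀ Φ₁ Φ₂ : Literature.MathematicalPhysics.QuantumManyBody.BoseGas.PeriodicTrialState N L, (∀ (X : Literature.MathematicalPhysics.QuantumManyBody.BoseGas.Config N) (t : EuclideanSpace ℝ (Fin 3)), Φ₁.ψ (fun i => X i + t) = Φ₁.ψ X) → (∀ (X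 : Literature.MathematicalPhysics.QuantumManyBody.BoseGas.Config N) (t : EuclideanSpace ℝ (Fin 3)), Φ₂.ψ (fun i => X i + t) = Φ₂.ψ X) → (∫ X in Literature.MathematicalPhysics.QuantumManyBody.BoseGas.cellN N L, starRingEnd ℂ (Φ₁.ψ X) * Φ₂.ψ X) = 0 → 2 * (⨅ Ψ : Literature.MathematicalPhysics.QuantumManyBody.BoseGas.PeriodicTrialState N L, (Literature.MathematicalPhysics.QuantumManyBody.BoseGas.periodicEnergy v Ψ + ENNReal.ofReal s * ((N : ENNReal) - Literature.MathematicalPhysics.QuantumManyBody.BoseGas.condensateOccupation N L Ψ.ψ))) + ENNReal.ofReal (g) ≤ (Literature.MathematicalPhysics.QuantumManyBody.BoseGas.periodicEnergy v Φ₁ + ENNReal.ofReal s * ((N : ENNReal) - Literature.MathematicalPhysics.QuantumManyBody.BoseGas.condensateOccupation N L Φ₁.ψ)) + (Literature.MathematicalPhysics.QuantumManyBody.BoseGas.periodicEnergy v Φ₂ + ENNReal.ofReal s * ((N : ENNReal) - Literature.MathematicalPhysics.QuantumManyBody.BoseGas.condensateOccupation N L Φ₂.ψ))) → (∃ δ :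 ENNReal, 0 < δ ∧ ∀ Ψ : Literature.MathematicalPhysics.QuantumManyBody.BoseGas.PeriodicTrialState N L, (Literature.MathematicalPhysics.QuantumManyBody.BoseGas.periodicEnergy v Ψ + ENNReal.ofReal s * ((N : ENNReal) - Literature.MathematicalPhysics.QuantumManyBody.BoseGas.condensateOccupation N L Ψ.ψ)) ≤ (⨅ Ψ : Literature.MathematicalPhysics.QuantumManyBody.BoseGas.PeriodicTrialState N L, (Literature.MathematicalPhysics.QuantumManyBody.BoseGas.periodicEnergy v Ψ + ENNReal.ofReal s * ((N : ENNReal) - Literature.MathematicalPhysics.QuantumManyBody.BoseGas.condensateOccupation N L Ψ.ψ))) + δ → ENNReal.ofReal ((L ^ 3)⁻¹ ^ 2) * (∫⁻ X in Literature.MathematicalPhysics.QuantumManyBody.BoseGas.cellN N L, (‖∑ i : Fin N, ∫ y in Literature.MathematicalPhysics.QuantumManyBody.BoseGas.cell L, Ψ.ψ (Function.update X i y)‖₊ : ENNReal) ^ 2) ≤ Literature.MathematicalPhysics.QuantumManyBody.BoseGas.condensateOccupation N L Ψ.ψ ^ 2 + ENNReal.ofReal (V)) → 2 * (⨅ Ψ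 : Literature.MathematicalPhysics.QuantumManyBody.BoseGas.PeriodicTrialState N L, (Literature.MathematicalPhysics.QuantumManyBody.BoseGas.periodicEnergy v Ψ + ENNReal.ofReal s * ((N : ENNReal) - Literature.MathematicalPhysics.QuantumManyBody.BoseGas.condensateOccupation N L Ψ.ψ))) ≤ (⨅ Ψ : Literature.MathematicalPhysics.QuantumManyBody.BoseGas.PeriodicTrialState N L, (Literature.MathematicalPhysics.QuantumManyBody.BoseGas.periodicEnergy v Ψ + ENNReal.ofReal (s + h) * ((N : ENNReal) - Literature.MathematicalPhysics.QuantumManyBody.BoseGas.condensateOccupation N L Ψ.ψ))) + (⨅ Ψ : Literature.MathematicalPhysics.QuantumManyBody.BoseGas.PeriodicTrialState N L, (Literature.MathematicalPhysics.QuantumManyBody.BoseGas.periodicEnergy v Ψ + ENNReal.ofReal (s - h) * ((N : ENNReal) - Literature.MathematicalPhysics.QuantumManyBody.BoseGas.condensateOccupation N L Ψ.ψ))) + ENNReal.ofReal (2 * h ^ 2 * V / (g - 2 * h * N)) := by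
  intro v hv N L s h g V hh hhs hg hgN hR hZM hGAP hVAR
  cases N with
  | zero =>
    simp only [Literature.MathematicalPhysics.QuantumManyBody.BoseGas.condensateOccupation,
      Literature.MathematicalPhysics.QuantumManyBody.BoseGas.occupation, Nat.cast_zero, tsub_zero,
      mul_zero, add_zero]
    rw [two_mul]
    exact le_self_add
  | succ n =>
    exact modulus_succ hv.1 hh hhs hg hgN hR hZM hGAP hVAR

end Summit.AtomisticToContinuum.BoseEinsteinCondensation.Cruxes.RewardChordBound.Birth

end
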